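import Summits.RiemannHypothesis.RiemannHypothesis.Theses.DBN
import Literature.NumberTheory.LFunctions.DeBruijnNewmanConstProofs
import Literature.NumberTheory.LFunctions.DeBruijnNewmanUpperBoundProofs
import Literature.Barriers.RiemannHypothesis.NewmanConjecture

/-!
# RiemannHypothesis / DBN — the target `DbnThesis` (item stmt-RiemannHypothesis-0274): bookkeeping

Route `RiemannHypothesis/DBN`, target X = `DBN.DbnThesis`:
`∀ t > 0, HasOnlyRealZeros (deBruijnH t)` (de Bruijn's `H_t`, Rodgers–Tao normalisation).

This support file records, sorry-free and WITHOUT named-fact hypotheses unless stated, what the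
tree already knows about X:

* `dbnThesis_iff_deBruijnNewmanConst_nonpos` — X ↔ `Λ ≤ 0` (Newman's characterisation,
  discharged in `DeBruijnNewmanConstProofs.lean`);
* `dbnThesis_iff_hasOnlyRealZeros_deBruijnH_zero` — X ↔ `H_0` has only real zeros (closedness at
  `t = 0`, Hurwitz; discharged ibid.);
* `dbnThesis_iff_riemannHypothesis`, `dbnThesis_iff_summit` — **X ↔ Mathlib's `RiemannHypothesis`**
  (`H_0 = ξ(1/2 + iz/2)/8`, discharged): the item is the Riemann hypothesis itself, verbatim up to a
  kernel-checked equivalence; in particular it can be closed neither by proof nor by refutation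
  short of settling RH;
* the route glue announced in the thesis ("#2 ∧ #3 → X is propositional"):
  `dbnThesis_of_dbnHighUniform_of_dbnLowAllT` and its converses, so that X closes in one line once
  the cruxes `DBN.DbnHighUniform` (stmt-0278) and `DBN.DbnLowAllT` (stmt-0281) do;
  `dbnThesis_iff_not_dbnNegativeLambdaPos` (X ↔ ¬ #5); `dbnPerTFinite_of_dbnThesis` (X → #4);
* reductions of X in the time variable: by de Bruijn monotonicity it suffices to have real zeros
  for arbitrarily small `t > 0` (`dbnThesis_iff_forall_exists_lt`); by `Λ ≤ 1/2` only
  `0 < t < 1/2` matters (`dbnThesis_iff_of_lt_one_half`); given Platt–Trudgian's `Λ ≤ 0.2`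
  (named fact `platt_trudgian`) only `0 < t ≤ 1/5` matters (`dbnThesis_iff_of_platt_trudgian`);
  and by the critical strip plus de Bruijn's Thm. 13 (`Polymath15.abs_im_le_sqrt_of_zero`) and the
  symmetries `z ↦ -z`, `z ↦ z̄` of the zero set, X is the absence of zeros of `H_t`,
  `0 < t < 1/2`, in the open quadrant-strip `0 < Re z`, `0 < Im z ≤ √(1 − 2t)`
  (`dbnThesis_iff_quadrant`);
* under Rodgers–Tao `Λ ≥ 0` (named fact `rodgers_tao` = barrier `NewmanConjecture`):
  X ↔ `Λ = 0` ↔ "`H_t` has only real zeros exactly for `t ≥ 0`" (`dbnThesis_iff_of_rodgers_tao`),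
  the zero-margin form of the target.

Nothing here closes the item; the file is `--supports stmt-RiemannHypothesis-0274`.
-/

namespace Summit.RiemannHypothesis.RiemannHypothesis.Theorems

open Literature.NumberTheory.LFunctions
open Summit.RiemannHypothesis.RiemannHypothesis.Theses

/-! ## X is `Λ ≤ 0`, i.e. RH -/

/-- X ↔ `Λ ≤ 0`: Newman's `sInf`-free characterisation `Λ ≤ t ↔ ∀ t' > t, H_{t'} real-rooted`
(`deBruijnNewmanConst_le_iff_holds`, Newman 1976 Thm. 3 + de Bruijn 1950 Thm. 13) at `t = 0`.
[folklore] -/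
theorem dbnThesis_iff_deBruijnNewmanConst_nonpos :
    DBN.DbnThesis ↔ deBruijnNewmanConst ≤ 0 :=
  (deBruijnNewmanConst_le_iff_holds 0).symm

/-- X ↔ `H_0` has only real zeros (Newman's closedness of `{t | H_t real-rooted}`, Hurwitz;
`hasOnlyRealZeros_deBruijnH_iff_deBruijnNewmanConst_le_holds` at `t = 0`). [folklore] -/
theorem dbnThesis_iff_hasOnlyRealZeros_deBruijnH_zero :
    DBN.DbnThesis ↔ HasOnlyRealZeros (deBruijnH 0) :=
  dbnThesis_iff_deBruijnNewmanConst_nonpos.trans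
    (hasOnlyRealZeros_deBruijnH_iff_deBruijnNewmanConst_le_holds 0).symm

/-- **X ↔ RH** (Mathlib's `RiemannHypothesis`), unconditionally in the tree: X ↔ `Λ ≤ 0`
(`dbnThesis_iff_deBruijnNewmanConst_nonpos`) ↔ RH (`riemannHypothesis_iff_deBruijnNewmanConst_nonpos`,
de Bruijn 1950 / Newman 1976 / Rodgers–Tao 2020 §1: "the Riemann hypothesis is then clearly
equivalent to the upper bound `Λ ≤ 0`"). The target item of route DBN is therefore the Riemann
hypothesis itself. [folklore] -/
theorem dbnThesis_iff_riemannHypothesis : DBN.DbnThesis ↔ _root_.RiemannHypothesis :=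
  dbnThesis_iff_deBruijnNewmanConst_nonpos.trans riemannHypothesis_iff_deBruijnNewmanConst_nonpos.symm

/-- X ↔ the summit statement `Summit.RiemannHypothesis` (definitionally Mathlib's). [folklore] -/
theorem dbnThesis_iff_summit : DBN.DbnThesis ↔ Summit.RiemannHypothesis :=
  dbnThesis_iff_riemannHypothesis

/-! ## The route glue: X versus the cruxes #2, #3, the support #4 and the negative side #5 -/

/-- **Glue `#2 → #3 → X`** ("#2 ∧ #3 → X is propositional", route thesis): high zeros real
(`DBN.DbnHighUniform`, `|Re z| ≥ 6·10¹²`) and low zeros real (`DBN.DbnLowAllT`, `|Re z| < 6·10¹²`)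
give all zeros real, for every `t > 0`. Once items stmt-0278 and stmt-0281 close, X closes by this
lemma applied to their `_holds` links. [folklore] -/
theorem dbnThesis_of_dbnHighUniform_of_dbnLowAllT (hhigh : DBN.DbnHighUniform)
    (hlow : DBN.DbnLowAllT) : DBN.DbnThesis := by
  intro t ht z hz
  rcases le_or_gt 6000000000000 |z.re| with hle | hlt
  · exact hhigh t ht z hz hle
  · exact hlow t ht z hz hlt

/-- Converse glue: X gives the high-zero crux #2. [folklore] -/
theorem dbnHighUniform_of_dbnThesis (h : DBN.DbnThesis) : DBN.DbnHighUniform :=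
  fun t ht z hz _ ↦ h t ht z hz

/-- Converse glue: X gives the low-zero crux #3. [folklore] -/
theorem dbnLowAllT_of_dbnThesis (h : DBN.DbnThesis) : DBN.DbnLowAllT :=
  fun t ht z hz _ ↦ h t ht z hz

/-- X is exactly the conjunction of the two cruxes #2 and #3. [folklore] -/
theorem dbnThesis_iff_dbnHighUniform_and_dbnLowAllT :
    DBN.DbnThesis ↔ DBN.DbnHighUniform ∧ DBN.DbnLowAllT :=
  ⟨fun h ↦ ⟨dbnHighUniform_of_dbnThesis h, dbnLowAllT_of_dbnThesis h⟩,
    fun h ↦ dbnThesis_of_dbnHighUniform_of_dbnLowAllT h.1 h.2⟩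

/-- X gives the per-`t` finiteness support item #4 (with threshold `T = 0`). [folklore] -/
theorem dbnPerTFinite_of_dbnThesis (h : DBN.DbnThesis) : DBN.DbnPerTFinite :=
  fun t ht ↦ ⟨0, fun z hz _ ↦ h t ht z hz⟩

/-- X is the negation of the negative-side item #5 (`Λ > 0` in `sInf`-free form). [folklore] -/
theorem dbnThesis_iff_not_dbnNegativeLambdaPos : DBN.DbnThesis ↔ ¬ DBN.DbnNegativeLambdaPos := by
  constructor
  · rintro h ⟨t, ht, hnot⟩
    exact hnot (h t ht)
  · intro h t ht
    by_contra hnot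
    exact h ⟨t, ht, hnot⟩

/-! ## Reductions in the time variable -/

/-- By de Bruijn's monotonicity (`mono_deBruijnH_holds`, Thm. 13), X holds as soon as `H_t` is
real-rooted for arbitrarily small positive times: X ↔ `∀ ε > 0, ∃ t ∈ (0, ε), H_t real-rooted`.
[folklore] -/
theorem dbnThesis_iff_forall_exists_lt :
    DBN.DbnThesis ↔ ∀ ε : ℝ, 0 < ε → ∃ t : ℝ, 0 < t ∧ t < ε ∧ HasOnlyRealZeros (deBruijnH t) := by
  constructor
  · intro h ε hε
    exact ⟨ε / 2, by positivity, by linarith, h (ε / 2) (by positivity)⟩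
  · intro h t ht
    obtain ⟨s, _, hsε, hs⟩ := h t ht
    exact mono_deBruijnH_holds hsε.le hs

/-- Since `Λ ≤ 1/2` (de Bruijn 1950; `hasOnlyRealZeros_deBruijnH_one_half_holds` and monotonicity),
only the window `0 < t < 1/2` matters: X ↔ `∀ t ∈ (0, 1/2), H_t real-rooted`. [folklore] -/
theorem dbnThesis_iff_of_lt_one_half :
    DBN.DbnThesis ↔ ∀ t : ℝ, 0 < t → t < 1 / 2 → HasOnlyRealZeros (deBruijnH t) := by
  constructor
  · exact fun h t ht _ ↦ h t ht
  · intro h t ht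
    rcases lt_or_ge t (1 / 2) with hlt | hge
    · exact h t ht hlt
    · exact mono_deBruijnH_holds hge hasOnlyRealZeros_deBruijnH_one_half_holds

/-- Given Platt–Trudgian's `Λ ≤ 0.2` in its `sInf`-free form (the named fact `platt_trudgian`:
`∀ t > 1/5, H_t real-rooted`; Bull. LMS 53 (2021), Cor. 2), only the window `0 < t ≤ 1/5`
matters: X ↔ `∀ t ∈ (0, 1/5], H_t real-rooted`. CONDITIONAL on `platt_trudgian`. [folklore] -/
theorem dbnThesis_iff_of_platt_trudgian (hPT : platt_trudgian) :
    DBN.DbnThesis ↔ ∀ t : ℝ, 0 < t → t ≤ 1 / 5 → HasOnlyRealZeros (deBruijnH t) := by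
  constructor
  · exact fun h t ht _ ↦ h t ht
  · intro h t ht
    rcases le_or_gt t (1 / 5) with hle | hgt
    · exact h t ht hle
    · exact hPT t hgt

/-- The window `t > 1/5` of X is known (Platt–Trudgian 2021, Cor. 2), CONDITIONAL on the named
fact `platt_trudgian` (itself reduced in the tree to RH-to-height-`3·10¹²` and Polymath 15's
Table 1 row 2, `platt_trudgian_of_numerics`). [folklore] -/
theorem hasOnlyRealZeros_deBruijnH_of_one_fifth_lt (hPT : platt_trudgian) {t : ℝ} (ht : 1 / 5 < t) :
    HasOnlyRealZeros (deBruijnH t) :=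
  hPT t ht

/-- **Quadrant-strip form of X.** The zero set of `H_t` is invariant under `z ↦ -z`
(`deBruijnH_neg`) and `z ↦ z̄` (`deBruijnH_conj_eq_zero`), has no purely imaginary points
(`Polymath15.re_ne_zero_of_zero`), and for `0 < t` lies in `|Im z| ≤ √max(1 − 2t, 0)`
(`Polymath15.abs_im_le_sqrt_of_zero`: critical strip + de Bruijn's Thm. 13); with `Λ ≤ 1/2`
this makes X equivalent to: for `0 < t < 1/2`, `H_t` has no zero with `0 < Re z` and
`0 < Im z ≤ √(1 − 2t)`. [folklore] -/
theorem dbnThesis_iff_quadrant :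
    DBN.DbnThesis ↔ ∀ t : ℝ, 0 < t → t < 1 / 2 → ∀ z : ℂ, deBruijnH t z = 0 → 0 < z.re →
      0 < z.im → z.im ≤ Real.sqrt (1 - 2 * t) → False := by
  constructor
  · intro h t ht _ z hz _ him _
    exact him.ne' (h t ht z hz)
  · intro h
    refine dbnThesis_iff_of_lt_one_half.2 fun t ht ht2 ↦ ?_
    -- first: no zero with `0 < Im z` (any sign of `Re z`)
    have hupper : ∀ w : ℂ, deBruijnH t w = 0 → 0 < w.im → False := by
      intro w hw hwim
      have hre : w.re ≠ 0 := Polymath15.re_ne_zero_of_zero hw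
      rcases lt_or_gt_of_ne hre with hneg | hpos
      · -- reflect: `-w̄` is a zero with positive real and imaginary parts
        have hw' : deBruijnH t (-(starRingEnd ℂ w)) = 0 := by
          rw [deBruijnH_neg]; exact deBruijnH_conj_eq_zero hw
        refine h t ht ht2 _ hw' ?_ ?_ ?_
        · simpa using hneg
        · simpa using hwim
        · have := Polymath15.im_le_sqrt_of_zero ht hw' (by simpa using hwim)
          simpa using this
      · exact h t ht ht2 w hw hpos hwim (Polymath15.im_le_sqrt_of_zero ht hw hwim)
    intro z hz
    rcases lt_trichotomy z.im 0 with hlt | heq | hgt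
    · exact (hupper _ (deBruijnH_conj_eq_zero hz) (by simpa using hlt)).elim
    · exact heq
    · exact (hupper z hz hgt).elim

/-! ## Under Rodgers–Tao `Λ ≥ 0`: the zero-margin form -/

/-- Under the named fact `rodgers_tao` (`Λ ≥ 0`, Rodgers–Tao 2020 Thm. 1.1; the catalogued barrier
`Literature.Barriers.RiemannHypothesis.NewmanConjecture`), X ↔ `Λ = 0`. CONDITIONAL on
`rodgers_tao`. [folklore] -/
theorem dbnThesis_iff_deBruijnNewmanConst_eq_zero (hRT : rodgers_tao) :
    DBN.DbnThesis ↔ deBruijnNewmanConst = 0 :=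
  dbnThesis_iff_riemannHypothesis.trans
    (riemannHypothesis_iff_deBruijnNewmanConst_eq_zero_of_rodgers_tao hRT)

/-- Under `rodgers_tao`, X says that `H_t` is real-rooted **exactly** for `t ≥ 0` — "if RH is true,
it is barely so": X ↔ `∀ t, (H_t real-rooted ↔ 0 ≤ t)`. CONDITIONAL on `rodgers_tao`.
[folklore] -/
theorem dbnThesis_iff_of_rodgers_tao (hRT : rodgers_tao) :
    DBN.DbnThesis ↔ ∀ t : ℝ, HasOnlyRealZeros (deBruijnH t) ↔ 0 ≤ t := by
  rw [dbnThesis_iff_deBruijnNewmanConst_eq_zero hRT]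
  constructor
  · intro h t
    rw [hasOnlyRealZeros_deBruijnH_iff_deBruijnNewmanConst_le_holds t, h]
  · intro h
    have h0 : HasOnlyRealZeros (deBruijnH 0) := (h 0).2 le_rfl
    have hle : deBruijnNewmanConst ≤ 0 :=
      (hasOnlyRealZeros_deBruijnH_iff_deBruijnNewmanConst_le_holds 0).1 h0
    have hge : 0 ≤ deBruijnNewmanConst :=
      (h deBruijnNewmanConst).1 hasOnlyRealZeros_deBruijnH_deBruijnNewmanConst
    exact le_antisymm hle hge

/-- The same with the catalogued barrier `NewmanConjecture` (≡ `rodgers_tao`) as hypothesis.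
CONDITIONAL on the barrier fact. [folklore] -/
theorem dbnThesis_iff_of_newmanConjecture
    (hN : Literature.Barriers.RiemannHypothesis.NewmanConjecture) :
    DBN.DbnThesis ↔ ∀ t : ℝ, HasOnlyRealZeros (deBruijnH t) ↔ 0 ≤ t :=
  dbnThesis_iff_of_rodgers_tao
    (Literature.Barriers.RiemannHypothesis.NewmanConjecture_iff_rodgers_tao.1 hN)

end Summit.RiemannHypothesis.RiemannHypothesis.Theorems
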